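/-
Copyright (c) 2026 the pub-hodgecm-mathlib formalisation cell (harness21).  Prover seat hodgecm-mathlib-K2E3-p12 (g4), Track B «K2-LIT» ∕ h413
(`stmt-HodgeConjecture-24833`), line `K2_E3_EllipticInputs`, unit U12-d, §L (G⁺-orb): THE NILPOTENT ORBITS OF A DETERMINANT SUBGROUP `det⁻¹(D) ≤ GL₂(F)` ON `𝔤𝔩₂(F)` ARE
THE DETERMINANT CLASSES `Fˣ ∕ D` — and the structure of `J(𝒩)^{det⁻¹(D)}` over class representatives.  2026-09-04.
-/
import Summits.HodgeConjecture.HodgeConjecture.Theorems.K2E3GL2NilpotentStructureOfSubgroupOrbits   -- (Gp-a) FILE 3 (this seat): `nilpotentStructure_of_subgroupOrbits`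
import HarnessLib

/-!
# K2_E3 road (h413), §L — (G⁺-orb): nilpotent orbits of `det⁻¹(D) ≤ GL₂(F)` = determinant classes; `J(𝒩)^{det⁻¹(D)}(𝔤𝔩₂(F))`

Cell `pub/hodgecm-mathlib` (D-0151), Track B, seat K2E3-p12 (g4), §L line lead (§L RULINGS #2∕#3; MEMO v3 76bc1f2b, road «U-iso-T»).  `--supports stmt-HodgeConjecture-24833
--as helper`; THEOREMS ONLY (no definition ∕ instance ∕ notation ∕ named fact ∕ `sorry`); never imports `Cruxes/…/Lines`.  COUNT-NEUTRAL.

For a subgroup `D ≤ Fˣ` containing the squares, the group `det⁻¹(D) ≤ GL₂(F)` — in the tree's `ConjAct` currency the subgroup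
`(D.comap det).comap ofConjAct ≤ ConjAct (GL (Fin 2) F)` — acts on the punctured nilpotent cone `𝒩 ∖ {0}` with orbits indexed by `Fˣ ∕ D`:
* §1 (any field) `isSquare_det_of_conj_nilpOne_eq` (the stabiliser `{[[a,b],[0,a]]}` of `E₁₂` has SQUARE determinants), `isSquare_det_mul_det_of_conj_nilpOne_eq`
  (`gE₁₂g⁻¹ = g′E₁₂g′⁻¹ ⇒ det g · det g′ ∈ (Fˣ)²`), `exists_diag_conj_nilpOne` (`tE₁₂ = d E₁₂ d⁻¹`, `det d = t`), `units_conj_conj`;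
* §2 `mem_detSubgroup_iff`; **`nilp_mem_orbit_detSubgroup_nilp_iff`**: `bE₁₂ ∈ det⁻¹(D) • (aE₁₂) ↔ a⁻¹b ∈ D`; **`mem_orbit_detSubgroup_nilp_det`**: `gE₁₂g⁻¹ ∈ det⁻¹(D) • ((det g)E₁₂)`
  (for ANY `D`); hence, for representatives `a : ι → Fˣ` of `Fˣ ∕ D`, the orbits `det⁻¹(D) • (aᵢE₁₂)` COVER `𝒩 ∖ {0}` (`exists_mem_orbit_detSubgroup_of_reps`, ★
  `exists_units_conj_nilp_one_eq`) and are PAIRWISE DISJOINT (`disjoint_orbit_detSubgroup_of_reps`); `isOpen_detSubgroup` (`D` open ⇒ `det⁻¹(D)` open, `det` continuous on `GL₂(F)`).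
* §3 **`nilpotentStructure_of_detSubgroup`** = ★ FILE 3 `nilpotentStructure_of_subgroupOrbits` for `det⁻¹(D)`: every distribution on `C_c^∞(𝔤𝔩₂(F))` that is additive,
  homogeneous, `Ad(det⁻¹ D)`-invariant and supported in `𝒩` is `a₀·δ₀ + Σᵢ cᵢ·ν|_{𝒪ᵢ}`.  THE CASE OF (L-B_U)′ :373 at `N = 2`, ISOTROPIC PLACE (MEMO v3 (G⁺-a)): `D = Nm(E_wˣ)`
  (index 2), two orbits `𝒪_± = det⁻¹(Nm) • (E₁₂), det⁻¹(Nm) • (εE₁₂)`, `ε ∉ Nm` — matching the U-side dictionary ★ p857063 `K2E3U11RegularNilpotentOrbits.unitary_conj_upperNilp_iff`.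
[HarishChandra1999AdmissibleDistributions, §3 Thm. 3.9, Cor. 3.10 («`dim J(𝒩)` = number of nilpotent orbits»)]; [RangaRao1972]; [BernsteinZelevinsky1976, §1.18].

References: [HarishChandra1999AdmissibleDistributions] Harish-Chandra (DeBacker–Sally), AMS ULECT 16 (1999), §3 pp. 8–10 · [RangaRao1972] Ann. of Math. 96 (1972) ·
[BernsteinZelevinsky1976] Russian Math. Surveys 31:3 (1976), §1.18.
-/

set_option autoImplicit false
set_option linter.dupNamespace false   -- `Summit.HodgeConjecture.HodgeConjecture.…` (D-0017 nested layout; lakefile exemption for Summits)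

noncomputable section

open MeasureTheory Measure Filter Topology TopologicalSpace
open scoped MatrixGroups NNReal ENNReal
open Literature.NumberTheory.Rogawski1990 Literature.NumberTheory.Automorphic Literature.NumberTheory.Automorphic.LocalFieldHaar
open Literature.NumberTheory.GaloisRepresentations Literature.NumberTheory.GaloisRepresentations.IsNonarchimedeanLocalField
open Summit.HodgeConjecture.HodgeConjecture.Cruxes.H413.K2E3GL2RegularNilpotentOrbitalMeasure
open Summit.HodgeConjecture.HodgeConjecture.Cruxes.H413.K2E3GL2RegularNilpotentOrbitStructure
open Summit.HodgeConjecture.HodgeConjecture.Cruxes.H413.K2E3GL2RegularNilpotentOrbitPushforward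
open Summit.HodgeConjecture.HodgeConjecture.Cruxes.H413.K2E3GL2RegularNilpotentOrbitSpace
open Summit.HodgeConjecture.HodgeConjecture.Cruxes.H413.K2E3GL2NilpotentSubgroupOrbitSpace
open Summit.HodgeConjecture.HodgeConjecture.Cruxes.H413.K2E3GL2NilpotentStructureOfSubgroupOrbits

namespace Summit.HodgeConjecture.HodgeConjecture.Cruxes.H413.K2E3GL2NilpotentOrbitsDetClass

/-! ## §1  Conjugating `E₁₂`: the stabiliser has square determinants; diagonal representatives -/

section Algebra

variable {F : Type*} [Field F]

/-- **The stabiliser of `E₁₂` in `GL₂(F)` has square determinants**: `gE₁₂g⁻¹ = E₁₂` forces `g = [[a,b],[0,a]]`, `det g = a²`.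
[cite: HarishChandra1999AdmissibleDistributions, §3 p. 8] -/
theorem isSquare_det_of_conj_nilpOne_eq (g : GL (Fin 2) F)
    (h : (g : Matrix (Fin 2) (Fin 2) F) * !![0, 1; 0, 0] * ((g⁻¹ : GL (Fin 2) F) : Matrix (Fin 2) (Fin 2) F) = !![0, 1; 0, 0]) :
    IsSquare ((g : Matrix (Fin 2) (Fin 2) F).det) := by
  have hcomm : (g : Matrix (Fin 2) (Fin 2) F) * !![0, 1; 0, 0] = !![0, 1; 0, 0] * (g : Matrix (Fin 2) (Fin 2) F) := by
    calc (g : Matrix (Fin 2) (Fin 2) F) * !![0, 1; 0, 0]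
        = (g : Matrix (Fin 2) (Fin 2) F) * !![0, 1; 0, 0] * (((g⁻¹ : GL (Fin 2) F) : Matrix (Fin 2) (Fin 2) F) * (g : Matrix (Fin 2) (Fin 2) F)) := by
          rw [Units.inv_mul, Matrix.mul_one]
      _ = (g : Matrix (Fin 2) (Fin 2) F) * !![0, 1; 0, 0] * ((g⁻¹ : GL (Fin 2) F) : Matrix (Fin 2) (Fin 2) F) * (g : Matrix (Fin 2) (Fin 2) F) := by
          simp only [Matrix.mul_assoc]
      _ = !![0, 1; 0, 0] * (g : Matrix (Fin 2) (Fin 2) F) := by rw [h]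
  have h10 : (g : Matrix (Fin 2) (Fin 2) F) 1 0 = 0 := by
    have := congr_fun (congr_fun hcomm 0) 0
    simp [Matrix.mul_apply, Fin.sum_univ_two] at this
    exact this.symm
  have h11 : (g : Matrix (Fin 2) (Fin 2) F) 0 0 = (g : Matrix (Fin 2) (Fin 2) F) 1 1 := by
    have := congr_fun (congr_fun hcomm 0) 1
    simpa [Matrix.mul_apply, Fin.sum_univ_two] using this
  refine ⟨(g : Matrix (Fin 2) (Fin 2) F) 0 0, ?_⟩
  rw [Matrix.det_fin_two, h10, mul_zero, sub_zero, h11]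

/-- Iterated conjugation: `k (d X d⁻¹) k⁻¹ = (kd) X (kd)⁻¹`. [folklore] -/
theorem units_conj_conj (k d : GL (Fin 2) F) (X : Matrix (Fin 2) (Fin 2) F) :
    (k : Matrix (Fin 2) (Fin 2) F) * ((d : Matrix (Fin 2) (Fin 2) F) * X * ((d⁻¹ : GL (Fin 2) F) : Matrix (Fin 2) (Fin 2) F)) *
        ((k⁻¹ : GL (Fin 2) F) : Matrix (Fin 2) (Fin 2) F) =
      ((k * d : GL (Fin 2) F) : Matrix (Fin 2) (Fin 2) F) * X * (((k * d)⁻¹ : GL (Fin 2) F) : Matrix (Fin 2) (Fin 2) F) := by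
  rw [mul_inv_rev, Units.val_mul, Units.val_mul]
  simp only [Matrix.mul_assoc]

/-- **The determinant class of a point of the regular nilpotent orbit is well defined**: `gE₁₂g⁻¹ = g′E₁₂g′⁻¹ ⇒ det g · det g′` is a square
(`g⁻¹g′` stabilises `E₁₂`). [cite: HarishChandra1999AdmissibleDistributions, §3 p. 8] -/
theorem isSquare_det_mul_det_of_conj_nilpOne_eq (g g' : GL (Fin 2) F)
    (h : (g : Matrix (Fin 2) (Fin 2) F) * !![0, 1; 0, 0] * ((g⁻¹ : GL (Fin 2) F) : Matrix (Fin 2) (Fin 2) F) =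
      (g' : Matrix (Fin 2) (Fin 2) F) * !![0, 1; 0, 0] * ((g'⁻¹ : GL (Fin 2) F) : Matrix (Fin 2) (Fin 2) F)) :
    IsSquare ((g : Matrix (Fin 2) (Fin 2) F).det * (g' : Matrix (Fin 2) (Fin 2) F).det) := by
  -- `k := g⁻¹ g'` fixes `E₁₂`
  have hk : ((g⁻¹ * g' : GL (Fin 2) F) : Matrix (Fin 2) (Fin 2) F) * !![0, 1; 0, 0] * (((g⁻¹ * g')⁻¹ : GL (Fin 2) F) : Matrix (Fin 2) (Fin 2) F) = !![0, 1; 0, 0] := by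
    rw [← units_conj_conj, ← h]
    have h1 : ((g⁻¹ : GL (Fin 2) F) : Matrix (Fin 2) (Fin 2) F) * (g : Matrix (Fin 2) (Fin 2) F) = 1 := Units.inv_mul _
    calc ((g⁻¹ : GL (Fin 2) F) : Matrix (Fin 2) (Fin 2) F) * ((g : Matrix (Fin 2) (Fin 2) F) * !![0, 1; 0, 0] * ((g⁻¹ : GL (Fin 2) F) : Matrix (Fin 2) (Fin 2) F)) *
          (((g⁻¹)⁻¹ : GL (Fin 2) F) : Matrix (Fin 2) (Fin 2) F)
        = (((g⁻¹ : GL (Fin 2) F) : Matrix (Fin 2) (Fin 2) F) * (g : Matrix (Fin 2) (Fin 2) F)) * !![0, 1; 0, 0] *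
            (((g⁻¹ : GL (Fin 2) F) : Matrix (Fin 2) (Fin 2) F) * (g : Matrix (Fin 2) (Fin 2) F)) := by
          rw [inv_inv]; simp only [Matrix.mul_assoc]
      _ = !![0, 1; 0, 0] := by rw [h1, Matrix.one_mul, Matrix.mul_one]
  obtain ⟨r, hr⟩ := isSquare_det_of_conj_nilpOne_eq (g⁻¹ * g') hk
  rw [Units.val_mul, Matrix.det_mul] at hr
  have hinv : (g : Matrix (Fin 2) (Fin 2) F).det * ((g⁻¹ : GL (Fin 2) F) : Matrix (Fin 2) (Fin 2) F).det = 1 := by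
    rw [← Matrix.det_mul, Units.mul_inv, Matrix.det_one]
  refine ⟨(g : Matrix (Fin 2) (Fin 2) F).det * r, ?_⟩
  calc (g : Matrix (Fin 2) (Fin 2) F).det * (g' : Matrix (Fin 2) (Fin 2) F).det
      = (g : Matrix (Fin 2) (Fin 2) F).det * (g' : Matrix (Fin 2) (Fin 2) F).det *
          ((g : Matrix (Fin 2) (Fin 2) F).det * ((g⁻¹ : GL (Fin 2) F) : Matrix (Fin 2) (Fin 2) F).det) := by rw [hinv, mul_one]
    _ = (g : Matrix (Fin 2) (Fin 2) F).det * (g : Matrix (Fin 2) (Fin 2) F).det *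
          (((g⁻¹ : GL (Fin 2) F) : Matrix (Fin 2) (Fin 2) F).det * (g' : Matrix (Fin 2) (Fin 2) F).det) := by ring
    _ = (g : Matrix (Fin 2) (Fin 2) F).det * r * ((g : Matrix (Fin 2) (Fin 2) F).det * r) := by rw [hr]; ring

/-- **Diagonal representatives**: `tE₁₂ = d E₁₂ d⁻¹` with `d = diag(t, 1)`, `det d = t` (`t ∈ Fˣ`). [cite: HarishChandra1999AdmissibleDistributions, §3 p. 9] -/
theorem exists_diag_conj_nilpOne (a : Fˣ) :
    ∃ d : GL (Fin 2) F, (d : Matrix (Fin 2) (Fin 2) F).det = a ∧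
      (d : Matrix (Fin 2) (Fin 2) F) * !![0, 1; 0, 0] * ((d⁻¹ : GL (Fin 2) F) : Matrix (Fin 2) (Fin 2) F) = !![0, (a : F); 0, 0] := by
  have hdet : (!![(a : F), 0; 0, 1] : Matrix (Fin 2) (Fin 2) F).det ≠ 0 := by
    rw [Matrix.det_fin_two]; simp [a.ne_zero]
  obtain ⟨d, hd⟩ : ∃ d : GL (Fin 2) F, (d : Matrix (Fin 2) (Fin 2) F) = !![(a : F), 0; 0, 1] := ⟨Matrix.GeneralLinearGroup.mkOfDetNeZero _ hdet, rfl⟩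
  refine ⟨d, ?_, ?_⟩
  · rw [hd, Matrix.det_fin_two]; simp
  · have hcomm : (d : Matrix (Fin 2) (Fin 2) F) * !![0, 1; 0, 0] = !![0, (a : F); 0, 0] * (d : Matrix (Fin 2) (Fin 2) F) := by
      rw [hd]
      ext i j
      fin_cases i <;> fin_cases j <;> simp [Matrix.mul_apply, Fin.sum_univ_two]
    rw [hcomm, Matrix.mul_assoc, Units.mul_inv, Matrix.mul_one]

/-- `tE₁₂` (`t ∈ Fˣ`) is a non-zero nilpotent. [cite: HarishChandra1999AdmissibleDistributions, §3 p. 8] -/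
theorem isNilpotent_nilp_and_ne_zero (a : Fˣ) : IsNilpotent (!![0, (a : F); 0, 0] : Matrix (Fin 2) (Fin 2) F) ∧ (!![0, (a : F); 0, 0] : Matrix (Fin 2) (Fin 2) F) ≠ 0 := by
  obtain ⟨d, -, hd⟩ := exists_diag_conj_nilpOne a
  rw [← hd]
  exact ⟨isNilpotent_conj_nilp d 1, fun h => one_ne_zero ((conjNilp_eq_zero_iff d (1 : F)).1 h)⟩

end Algebra

/-! ## §2  The orbits of `det⁻¹(D)` on the punctured nilpotent cone are the classes `Fˣ ∕ D` -/

section DetSubgroup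

variable {F : Type*} [Field F] (D : Subgroup Fˣ)

/-- Membership in `det⁻¹(D) ≤ ConjAct GL₂(F)`: `g ∈ (D.comap det).comap ofConjAct ↔ det g ∈ D`. [folklore] -/
theorem mem_detSubgroup_iff (g : ConjAct (GL (Fin 2) F)) :
    g ∈ ((D.comap (Matrix.GeneralLinearGroup.det : GL (Fin 2) F →* Fˣ)).comap
        (ConjAct.ofConjAct : ConjAct (GL (Fin 2) F) ≃* GL (Fin 2) F).toMonoidHom) ↔
      Matrix.GeneralLinearGroup.det (ConjAct.ofConjAct g) ∈ D := by
  simp only [Subgroup.mem_comap, MulEquiv.coe_toMonoidHom]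

/-- `det d = a` as units. [folklore] -/
theorem det_eq_of_val_det_eq {d : GL (Fin 2) F} {a : Fˣ} (h : (d : Matrix (Fin 2) (Fin 2) F).det = a) : Matrix.GeneralLinearGroup.det d = a :=
  Units.ext h

/-- **`gE₁₂g⁻¹ ∈ det⁻¹(D) • ((det g)E₁₂)`** — for ANY subgroup `D` (the conjugator `g·diag(det g,1)⁻¹` has determinant `1`).
[cite: HarishChandra1999AdmissibleDistributions, §3 p. 9] -/
theorem mem_orbit_detSubgroup_nilp_det (g : GL (Fin 2) F) :
    (g : Matrix (Fin 2) (Fin 2) F) * !![0, 1; 0, 0] * ((g⁻¹ : GL (Fin 2) F) : Matrix (Fin 2) (Fin 2) F) ∈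
      MulAction.orbit ↥((D.comap (Matrix.GeneralLinearGroup.det : GL (Fin 2) F →* Fˣ)).comap
        (ConjAct.ofConjAct : ConjAct (GL (Fin 2) F) ≃* GL (Fin 2) F).toMonoidHom)
        (!![0, ((Matrix.GeneralLinearGroup.det g : Fˣ) : F); 0, 0] : Matrix (Fin 2) (Fin 2) F) := by
  obtain ⟨d, hdd, hd⟩ := exists_diag_conj_nilpOne (F := F) (Matrix.GeneralLinearGroup.det g)
  have hmem : ConjAct.toConjAct (g * d⁻¹) ∈ ((D.comap (Matrix.GeneralLinearGroup.det : GL (Fin 2) F →* Fˣ)).comap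
      (ConjAct.ofConjAct : ConjAct (GL (Fin 2) F) ≃* GL (Fin 2) F).toMonoidHom) := by
    rw [mem_detSubgroup_iff, ConjAct.ofConjAct_toConjAct, map_mul, map_inv, det_eq_of_val_det_eq hdd, mul_inv_cancel]
    exact D.one_mem
  refine MulAction.mem_orbit_iff.2 ⟨⟨ConjAct.toConjAct (g * d⁻¹), hmem⟩, ?_⟩
  rw [Subgroup.mk_smul, ConjAct.units_smul_def, ConjAct.ofConjAct_toConjAct, ← hd, units_conj_conj, inv_mul_cancel_right]

/-- **`bE₁₂ ∈ det⁻¹(D) • (aE₁₂) ↔ a⁻¹b ∈ D`** when `D` contains the squares. [cite: HarishChandra1999AdmissibleDistributions, §3 Thm. 3.9, Cor. 3.10] -/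
theorem nilp_mem_orbit_detSubgroup_nilp_iff (hD2 : ∀ u : Fˣ, u * u ∈ D) (a b : Fˣ) :
    (!![0, (b : F); 0, 0] : Matrix (Fin 2) (Fin 2) F) ∈
        MulAction.orbit ↥((D.comap (Matrix.GeneralLinearGroup.det : GL (Fin 2) F →* Fˣ)).comap
          (ConjAct.ofConjAct : ConjAct (GL (Fin 2) F) ≃* GL (Fin 2) F).toMonoidHom) (!![0, (a : F); 0, 0] : Matrix (Fin 2) (Fin 2) F) ↔
      a⁻¹ * b ∈ D := by
  obtain ⟨da, hdda, hda⟩ := exists_diag_conj_nilpOne (F := F) a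
  obtain ⟨db, hddb, hdb⟩ := exists_diag_conj_nilpOne (F := F) b
  constructor
  · intro h
    obtain ⟨k, hk⟩ := MulAction.mem_orbit_iff.1 h
    rw [Subgroup.smul_def, ConjAct.units_smul_def, ← hda, ← hdb, units_conj_conj] at hk
    obtain ⟨r, hr⟩ := isSquare_det_mul_det_of_conj_nilpOne_eq _ _ hk
    rw [Units.val_mul, Matrix.det_mul, hdda, hddb] at hr
    -- `det k · a · b = r²` with `det k ∈ D`
    have hkD : Matrix.GeneralLinearGroup.det (ConjAct.ofConjAct (k : ConjAct (GL (Fin 2) F))) ∈ D := (mem_detSubgroup_iff D _).1 k.2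
    have hr0 : r ≠ 0 := by
      intro hr0
      rw [hr0, mul_zero] at hr
      exact mul_ne_zero (mul_ne_zero (Matrix.GeneralLinearGroup.det_ne_zero _) a.ne_zero) b.ne_zero hr
    have hab : a⁻¹ * b = (Matrix.GeneralLinearGroup.det (ConjAct.ofConjAct (k : ConjAct (GL (Fin 2) F))))⁻¹ * ((a⁻¹ * a⁻¹) * (Units.mk0 r hr0 * Units.mk0 r hr0)) := by
      have hdet0 : (Matrix.GeneralLinearGroup.det (ConjAct.ofConjAct (k : ConjAct (GL (Fin 2) F))) : F) ≠ 0 := Units.ne_zero _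
      apply Units.ext
      push_cast
      simp only [Units.val_mk0]
      rw [Matrix.GeneralLinearGroup.val_det_apply] at hdet0 ⊢
      field_simp
      linear_combination hr
    rw [hab]
    exact D.mul_mem (D.inv_mem hkD) (D.mul_mem (hD2 a⁻¹) (hD2 (Units.mk0 r hr0)))
  · intro hab
    have hmem : ConjAct.toConjAct (db * da⁻¹) ∈ ((D.comap (Matrix.GeneralLinearGroup.det : GL (Fin 2) F →* Fˣ)).comap
        (ConjAct.ofConjAct : ConjAct (GL (Fin 2) F) ≃* GL (Fin 2) F).toMonoidHom) := by
      rw [mem_detSubgroup_iff, ConjAct.ofConjAct_toConjAct, map_mul, map_inv, det_eq_of_val_det_eq hdda, det_eq_of_val_det_eq hddb, mul_comm]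
      exact hab
    refine MulAction.mem_orbit_iff.2 ⟨⟨ConjAct.toConjAct (db * da⁻¹), hmem⟩, ?_⟩
    rw [Subgroup.mk_smul, ConjAct.units_smul_def, ConjAct.ofConjAct_toConjAct, ← hda, units_conj_conj, inv_mul_cancel_right, hdb]

/-- **COVER**: if `a : ι → Fˣ` meets every class of `Fˣ ∕ D`, then every non-zero nilpotent lies in some orbit `det⁻¹(D) • (aᵢE₁₂)` (★ `exists_units_conj_nilp_one_eq`).
[cite: HarishChandra1999AdmissibleDistributions, §3 Thm. 3.9] -/
theorem exists_mem_orbit_detSubgroup_of_reps (hD2 : ∀ u : Fˣ, u * u ∈ D) {ι : Type*} (a : ι → Fˣ)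
    (hcov : ∀ u : Fˣ, ∃ i, (a i)⁻¹ * u ∈ D) {X : Matrix (Fin 2) (Fin 2) F} (hX : IsNilpotent X) (h0 : X ≠ 0) :
    ∃ i, X ∈ MulAction.orbit ↥((D.comap (Matrix.GeneralLinearGroup.det : GL (Fin 2) F →* Fˣ)).comap
      (ConjAct.ofConjAct : ConjAct (GL (Fin 2) F) ≃* GL (Fin 2) F).toMonoidHom) (!![0, (a i : F); 0, 0] : Matrix (Fin 2) (Fin 2) F) := by
  obtain ⟨g, hg⟩ := exists_units_conj_nilp_one_eq hX h0
  obtain ⟨i, hi⟩ := hcov (Matrix.GeneralLinearGroup.det g)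
  refine ⟨i, ?_⟩
  rw [← MulAction.orbit_eq_iff.2 ((nilp_mem_orbit_detSubgroup_nilp_iff D hD2 (a i) (Matrix.GeneralLinearGroup.det g)).2 hi), ← hg]
  exact mem_orbit_detSubgroup_nilp_det D g

/-- **DISJOINTNESS**: representatives of distinct classes give disjoint orbits. [cite: HarishChandra1999AdmissibleDistributions, §3 Thm. 3.9] -/
theorem disjoint_orbit_detSubgroup_of_reps (hD2 : ∀ u : Fˣ, u * u ∈ D) {ι : Type*} (a : ι → Fˣ)
    (hdis : ∀ i j, i ≠ j → (a i)⁻¹ * a j ∉ D) (i j : ι) (hij : i ≠ j) :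
    Disjoint
      (MulAction.orbit ↥((D.comap (Matrix.GeneralLinearGroup.det : GL (Fin 2) F →* Fˣ)).comap
        (ConjAct.ofConjAct : ConjAct (GL (Fin 2) F) ≃* GL (Fin 2) F).toMonoidHom) (!![0, (a i : F); 0, 0] : Matrix (Fin 2) (Fin 2) F))
      (MulAction.orbit ↥((D.comap (Matrix.GeneralLinearGroup.det : GL (Fin 2) F →* Fˣ)).comap
        (ConjAct.ofConjAct : ConjAct (GL (Fin 2) F) ≃* GL (Fin 2) F).toMonoidHom) (!![0, (a j : F); 0, 0] : Matrix (Fin 2) (Fin 2) F)) := by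
  rcases orbit_subgroup_disjoint_or_eq ((D.comap (Matrix.GeneralLinearGroup.det : GL (Fin 2) F →* Fˣ)).comap
      (ConjAct.ofConjAct : ConjAct (GL (Fin 2) F) ≃* GL (Fin 2) F).toMonoidHom) (x₀ := (!![0, (a j : F); 0, 0] : Matrix (Fin 2) (Fin 2) F))
      (!![0, (a i : F); 0, 0] : Matrix (Fin 2) (Fin 2) F) with h | h
  · exact h
  · exfalso
    refine hdis i j hij ((nilp_mem_orbit_detSubgroup_nilp_iff D hD2 (a i) (a j)).1 ?_)
    rw [h]
    exact MulAction.mem_orbit_self _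

variable [TopologicalSpace F] [IsTopologicalRing F]

/-- **`det⁻¹(D)` is open when `D` is** (`det : GL₂(F) → Fˣ` is continuous for the unit-group topologies). [folklore] -/
theorem isOpen_detSubgroup (hD : IsOpen (D : Set Fˣ)) :
    IsOpen {g : GL (Fin 2) F | ConjAct.toConjAct g ∈ ((D.comap (Matrix.GeneralLinearGroup.det : GL (Fin 2) F →* Fˣ)).comap
      (ConjAct.ofConjAct : ConjAct (GL (Fin 2) F) ≃* GL (Fin 2) F).toMonoidHom)} := by
  have hdet : Continuous fun g : GL (Fin 2) F => Matrix.GeneralLinearGroup.det g := by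
    refine Units.continuous_iff.2 ⟨?_, ?_⟩
    · exact Units.continuous_val.matrix_det
    · exact Units.continuous_coe_inv.matrix_det
  have hset : {g : GL (Fin 2) F | ConjAct.toConjAct g ∈ ((D.comap (Matrix.GeneralLinearGroup.det : GL (Fin 2) F →* Fˣ)).comap
      (ConjAct.ofConjAct : ConjAct (GL (Fin 2) F) ≃* GL (Fin 2) F).toMonoidHom)} =
      (fun g : GL (Fin 2) F => Matrix.GeneralLinearGroup.det g) ⁻¹' (D : Set Fˣ) := by
    ext g
    simp only [Set.mem_setOf_eq, mem_detSubgroup_iff, ConjAct.ofConjAct_toConjAct, Set.mem_preimage, SetLike.mem_coe]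
  rw [hset]
  exact hD.preimage hdet

end DetSubgroup

/-! ## §3  The structure of `J(𝒩)^{det⁻¹(D)}(𝔤𝔩₂(F))` over class representatives -/

section Structure

variable {F : Type*} [Field F] [ValuativeRel F] [TopologicalSpace F] [IsNonarchimedeanLocalField F] (D : Subgroup Fˣ)

set_option maxHeartbeats 800000 in
/-- **STRUCTURE OF `J(𝒩)^{det⁻¹(D)}(𝔤𝔩₂(F))`.**  `D ≤ Fˣ` open containing the squares, `a : ι → Fˣ` (`ι` finite) representatives of `Fˣ ∕ D` (every class met, pairwise
distinct classes), `(κ, dx)` a Haar pair on `GL₂(𝒪_F) × F`.  Every `T` on `C_c^∞(𝔤𝔩₂(F))` that is additive, homogeneous, invariant under `Ad(g)` for `det g ∈ D`, and zero on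
test functions whose support meets no nilpotent, is `T f = a₀·f(0) + Σᵢ cᵢ · ∫_{chart⁻¹(det⁻¹(D) • aᵢE₁₂)} f(k (tE₁₂) k⁻¹) d(κ ⊗ dx)`.  (★ FILE 3 + §2.)  For `D = Nm(E_wˣ)`, `ι = Fin 2`,
this is the 𝔤𝔩₂-side of (L-B_U)′ at an isotropic place (MEMO v3 (G⁺-a)). [cite: HarishChandra1999AdmissibleDistributions, Thm. 3.9, Cor. 3.10 p. 10] [cite: BernsteinZelevinsky1976, §1.18] -/
theorem nilpotentStructure_of_detSubgroup (hDo : IsOpen (D : Set Fˣ)) (hD2 : ∀ u : Fˣ, u * u ∈ D)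
    {ι : Type*} [Fintype ι] (a : ι → Fˣ) (hcov : ∀ u : Fˣ, ∃ i, (a i)⁻¹ * u ∈ D) (hdis : ∀ i j, i ≠ j → (a i)⁻¹ * a j ∉ D)
    [MeasurableSpace F] [BorelSpace F] [MeasurableSpace (GL (Fin 2) F)] [BorelSpace (GL (Fin 2) F)]
    (κ : Measure ↥(glInt 2 F)) [IsHaarMeasure κ] (dx : Measure F) [dx.IsAddHaarMeasure]
    (T : (Matrix (Fin 2) (Fin 2) F → ℂ) → ℂ)
    (hT1 : ∀ f₁ f₂ : Matrix (Fin 2) (Fin 2) F → ℂ, IsLocSmooth f₁ → IsLocSmooth f₂ → T (f₁ + f₂) = T f₁ + T f₂)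
    (hT2 : ∀ (c : ℂ) (f : Matrix (Fin 2) (Fin 2) F → ℂ), IsLocSmooth f → T (c • f) = c * T f)
    (hT3 : ∀ g : GL (Fin 2) F, Matrix.GeneralLinearGroup.det g ∈ D → ∀ f : Matrix (Fin 2) (Fin 2) F → ℂ, IsLocSmooth f →
      T (fun X => f ((g : Matrix (Fin 2) (Fin 2) F) * X * ((g⁻¹ : GL (Fin 2) F) : Matrix (Fin 2) (Fin 2) F))) = T f)
    (hT4 : ∀ f : Matrix (Fin 2) (Fin 2) F → ℂ, IsLocSmooth f → (∀ X ∈ tsupport f, ¬ IsNilpotent X) → T f = 0) :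
    ∃ (a₀ : ℂ) (c : ι → ℂ), ∀ f : Matrix (Fin 2) (Fin 2) F → ℂ, IsLocSmooth f →
      T f = a₀ * f 0 + ∑ i, c i * ∫ p in {p : ↥(glInt 2 F) × F | ((p.1 : GL (Fin 2) F) : Matrix (Fin 2) (Fin 2) F) * !![0, p.2; 0, 0] *
          ((((p.1 : GL (Fin 2) F))⁻¹ : GL (Fin 2) F) : Matrix (Fin 2) (Fin 2) F) ∈
            MulAction.orbit ↥((D.comap (Matrix.GeneralLinearGroup.det : GL (Fin 2) F →* Fˣ)).comap
              (ConjAct.ofConjAct : ConjAct (GL (Fin 2) F) ≃* GL (Fin 2) F).toMonoidHom) (!![0, (a i : F); 0, 0] : Matrix (Fin 2) (Fin 2) F)},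
        f (((p.1 : GL (Fin 2) F) : Matrix (Fin 2) (Fin 2) F) * !![0, p.2; 0, 0] * ((((p.1 : GL (Fin 2) F))⁻¹ : GL (Fin 2) F) : Matrix (Fin 2) (Fin 2) F)) ∂(κ.prod dx) :=
  nilpotentStructure_of_subgroupOrbits _ (isOpen_detSubgroup D hDo) (fun i => (!![0, (a i : F); 0, 0] : Matrix (Fin 2) (Fin 2) F))
    (fun i => (isNilpotent_nilp_and_ne_zero (a i)).1) (fun i => (isNilpotent_nilp_and_ne_zero (a i)).2)
    (fun X hX h0 => exists_mem_orbit_detSubgroup_of_reps D hD2 a hcov hX h0) (disjoint_orbit_detSubgroup_of_reps D hD2 a hdis)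
    κ dx T hT1 hT2 (fun g hg => hT3 g (by rwa [mem_detSubgroup_iff, ConjAct.ofConjAct_toConjAct] at hg)) hT4

end Structure

end Summit.HodgeConjecture.HodgeConjecture.Cruxes.H413.K2E3GL2NilpotentOrbitsDetClass
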